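import Literature.Algebra.Polynomial.PowerSeriesInDeltaOperator
import Mathlib.Tactic
import HarnessLib

/-!
# The Pincherle derivative `T′ = Tx − xT` (Rota–Kahaner–Odlyzko §4)

G.-C. Rota, D. Kahaner, A. Odlyzko, *Finite operator calculus* (1973), §4 "The Pincherle derivative",
pp. 694–695:

> For the first time we introduce operators that are not shift-invariant. The simplest is multiplication
> by `x`. … For any operator `T` defined on `P`, the operator `T′ = Tx − xT` will be called the
> *Pincherle derivative* of the operator `T`.
> **Proposition 1.** If `T` is a shift-invariant operator, then its Pincherle derivative `T′ = Tx − xT` is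
> also a shift-invariant operator.
> … `T = Σ_k a_k/k! Dᵏ` where `a_k = [T xᵏ]_{x=0}` … the formal power series `Σ_k a_k tᵏ/k! = f (t)` … We call
> `f (t)` the indicator of `T`.
> **Proposition 2.** If `T` has indicator `f (t)`, then its Pincherle derivative `T′` has `f′(t)` as its
> indicator.
> **Proposition 3.** `(TS)′ = T′S + TS′`.
> **Proposition 4.** `Q` is a delta operator if and only if `Q = DP` for some shift-invariant operator `P`,
> where the inverse operator `P⁻¹` exists.

The tree has the Pincherle identity for composition operators already (`diffOp_comp_mulLeft_sub`:
`φ(D) x − x φ(D) = φ′(D)`, `BasicSequenceClosedForms`; Robert Ch. IV §5.5 Lemma) but no name for the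
operation `T ↦ T′` on ALL operators; this file introduces it as a definition and proves Propositions 1–4
as printed: `pincherle T = T ∘ x − x ∘ T` (`pincherle`, `pincherle_apply`), Proposition 1
(`IsShiftInvariant.pincherle`), Proposition 2 (`pincherle_diffOp`: `(φ(D))′ = φ′(D)`, and with the
indicator `indicator_pincherle`), Proposition 3 in full generality — `T ↦ T′` is a derivation of the
operator algebra (`pincherle_comp`; also `pincherle_add`, `pincherle_smul`, `pincherle_id`, `pincherle_derivative`:
`D′ = I`, `pincherle_mulLeft_X`: `x′ = 0`), and Proposition 4 (`isDeltaOperator_iff_exists_eq_derivative_comp`,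
assembling the tree's `IsDeltaOperator.exists_eq_derivative_comp` and `isDeltaOperator_derivative_comp_diffOp`).

## References
* [RotaKahanerOdlyzko1973] G.-C. Rota, D. Kahaner, A. Odlyzko, *On the foundations of
  combinatorial theory VIII. Finite operator calculus*, J. Math. Anal. Appl. 42 (1973) 684–760,
  §4, pp. 694–695.
* [Robert2000PadicAnalysis] A. M. Robert, *A Course in p-adic Analysis*, GTM 198, Springer (2000),
  Ch. IV §5.5 Lemma and Comment ("Pincherle derivative"), p. 203.
-/

noncomputable section

open Polynomial

namespace Literature.Algebra.Polynomial

variable {K : Type*} [Field K]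

/-- **The Pincherle derivative** `T′ = Tx − xT` of a linear operator `T` on `K[x]` (`x` = multiplication
by the variable). [cite: RotaKahanerOdlyzko1973, §4 ("`T′ = Tx − xT` will be called the Pincherle
derivative of the operator `T`"), p. 694] [cite: Robert2000PadicAnalysis, Ch. IV §5.5 Comment, p. 203] -/
def pincherle (T : K[X] →ₗ[K] K[X]) : K[X] →ₗ[K] K[X] :=
  T ∘ₗ LinearMap.mulLeft K (X : K[X]) - LinearMap.mulLeft K (X : K[X]) ∘ₗ T

/-- Unfolding: `T′ f = T (x f) − x T f`. [cite: RotaKahanerOdlyzko1973, §4, p. 694] -/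
theorem pincherle_apply (T : K[X] →ₗ[K] K[X]) (f : K[X]) : pincherle T f = T (X * f) - X * T f := by
  rw [pincherle, LinearMap.sub_apply, LinearMap.comp_apply, LinearMap.comp_apply, LinearMap.mulLeft_apply,
    LinearMap.mulLeft_apply]

/-- The definition as an operator identity: `T′ = T ∘ x − x ∘ T`. [cite: RotaKahanerOdlyzko1973, §4, p. 694] -/
theorem pincherle_eq (T : K[X] →ₗ[K] K[X]) :
    pincherle T = T ∘ₗ LinearMap.mulLeft K (X : K[X]) - LinearMap.mulLeft K (X : K[X]) ∘ₗ T :=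
  rfl

/-- `T ↦ T′` is additive. [cite: RotaKahanerOdlyzko1973, §4, p. 694] -/
theorem pincherle_add (T S : K[X] →ₗ[K] K[X]) : pincherle (T + S) = pincherle T + pincherle S := by
  simp only [pincherle_eq, LinearMap.add_comp, LinearMap.comp_add]
  abel

/-- `T ↦ T′` is homogeneous. [cite: RotaKahanerOdlyzko1973, §4, p. 694] -/
theorem pincherle_smul (c : K) (T : K[X] →ₗ[K] K[X]) : pincherle (c • T) = c • pincherle T := by
  simp only [pincherle_eq, LinearMap.smul_comp, LinearMap.comp_smul, smul_sub]

/-- `I′ = 0`. [cite: RotaKahanerOdlyzko1973, §4, p. 694] -/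
theorem pincherle_id : pincherle (LinearMap.id : K[X] →ₗ[K] K[X]) = 0 := by
  rw [pincherle_eq, LinearMap.id_comp, LinearMap.comp_id, sub_self]

/-- `x′ = 0` (the multiplication operator commutes with itself). [cite: RotaKahanerOdlyzko1973, §4, p. 694] -/
theorem pincherle_mulLeft_X : pincherle (LinearMap.mulLeft K (X : K[X])) = 0 := by
  rw [pincherle_eq, sub_self]

/-- **Proposition 3: `(TS)′ = T′S + TS′`** — for ALL operators `T`, `S` (the commutator with `x` is a
derivation). [cite: RotaKahanerOdlyzko1973, §4 Proposition 3, p. 695] -/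
theorem pincherle_comp (T S : K[X] →ₗ[K] K[X]) :
    pincherle (T ∘ₗ S) = pincherle T ∘ₗ S + T ∘ₗ pincherle S := by
  simp only [pincherle_eq, LinearMap.sub_comp, LinearMap.comp_sub, LinearMap.comp_assoc]
  abel

/-- **`D′ = I`**: `D (x f) − x D f = f`. [cite: RotaKahanerOdlyzko1973, §4, p. 694]
[cite: Robert2000PadicAnalysis, Ch. IV §5.5, p. 203] -/
theorem pincherle_derivative : pincherle (derivative : K[X] →ₗ[K] K[X]) = LinearMap.id := by
  apply LinearMap.ext
  intro f
  rw [pincherle_apply, derivative_mul, derivative_X, one_mul, LinearMap.id_apply, add_sub_cancel_right]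

/-- **Proposition 2 (and 1) for a composition operator written as `φ(D)`**: `(φ(D))′ = φ′(D)`.
[cite: RotaKahanerOdlyzko1973, §4 Propositions 1–2, pp. 694–695] [cite: Robert2000PadicAnalysis, Ch. IV §5.5
Lemma, p. 203] -/
theorem pincherle_diffOp (φ : PowerSeries K) : pincherle (diffOp φ) = diffOp (PowerSeries.derivative K φ) :=
  diffOp_comp_mulLeft_sub φ

variable [CharZero K]

/-- **Proposition 1: the Pincherle derivative of a shift-invariant operator is shift-invariant.**
[cite: RotaKahanerOdlyzko1973, §4 Proposition 1, p. 694] -/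
theorem IsShiftInvariant.pincherle {T : K[X] →ₗ[K] K[X]} (hT : IsShiftInvariant T) :
    IsShiftInvariant (pincherle T) := by
  obtain ⟨φ, rfl⟩ := isShiftInvariant_iff_exists_eq_diffOp.1 hT
  rw [pincherle_diffOp]
  exact isShiftInvariant_diffOp _

/-- **Proposition 2: "If `T` has indicator `f (t)`, then its Pincherle derivative `T′` has `f′(t)` as its
indicator"** (indicator relative to `D`). [cite: RotaKahanerOdlyzko1973, §4 Proposition 2, p. 695] -/
theorem indicator_pincherle {T : K[X] →ₗ[K] K[X]} (hT : IsShiftInvariant T) :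
    (isDeltaOperator_derivative (K := K)).indicator (pincherle T) =
      PowerSeries.derivative K ((isDeltaOperator_derivative (K := K)).indicator T) := by
  conv_lhs => rw [hT.eq_diffOp_indicator, pincherle_diffOp, indicator_derivative_diffOp]

/-- The Pincherle derivative of a power `(φ(D)ⁿ)′ = n φ(D)^{n−1} φ′(D)`, e.g.
"`((D − I)ⁿ)′ = n (D − I)^{n−1}`". [cite: RotaKahanerOdlyzko1973, §4 Proposition 2, p. 695]
[cite: RotaKahanerOdlyzko1973, §11 ("Using the Pincherle derivative identity …"), p. 728] -/
theorem pincherle_diffOp_pow (φ : PowerSeries K) (n : ℕ) :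
    pincherle (diffOp φ ^ n) = (n : K) • ((diffOp φ ^ (n - 1)) ∘ₗ diffOp (PowerSeries.derivative K φ)) := by
  rw [← diffOp_pow, pincherle_diffOp, PowerSeries.derivative_pow, mul_assoc,
    ← map_natCast (PowerSeries.C : K →+* PowerSeries K) n, ← PowerSeries.smul_eq_C_mul, diffOp_smul, diffOp_mul,
    diffOp_pow]

/-- **Proposition 4: "`Q` is a delta operator if and only if `Q = DP` for some shift-invariant operator `P`,
where the inverse operator `P⁻¹` exists"** (`P = ψ(D)` with `ψ (0) ≠ 0`).
[cite: RotaKahanerOdlyzko1973, §4 Proposition 4, p. 695] -/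
theorem isDeltaOperator_iff_exists_eq_derivative_comp {Q : K[X] →ₗ[K] K[X]} :
    IsDeltaOperator Q ↔ ∃ ψ : PowerSeries K, PowerSeries.constantCoeff ψ ≠ 0 ∧ Q = derivative ∘ₗ diffOp ψ :=
  ⟨fun hQ => hQ.exists_eq_derivative_comp, fun ⟨_, hψ, h⟩ => h ▸ isDeltaOperator_derivative_comp_diffOp hψ⟩

/-- **`Q′` is invertible for a delta operator `Q`**: for `Q = D ψ(D)`, `Q′ = (tψ)′(D)` has symbol with
constant term `ψ (0) ≠ 0` (used throughout Theorem 4: `(Q′)⁻¹`).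
[cite: RotaKahanerOdlyzko1973, §4 Theorem 4, p. 695] -/
theorem pincherle_derivative_comp_diffOp (ψ : PowerSeries K) :
    pincherle (derivative ∘ₗ diffOp ψ) = diffOp (PowerSeries.derivative K (PowerSeries.X * ψ)) := by
  rw [derivative_comp_diffOp_eq, pincherle_diffOp]

/-- … and that symbol is invertible: `((tψ)′)(0) = ψ (0) ≠ 0`.
[cite: RotaKahanerOdlyzko1973, §4 Theorem 4, p. 695] -/
theorem bijective_pincherle_of_isDeltaOperator {Q : K[X] →ₗ[K] K[X]} (hQ : IsDeltaOperator Q) :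
    Function.Bijective (pincherle Q) := by
  obtain ⟨ψ, hψ, rfl⟩ := hQ.exists_eq_derivative_comp
  rw [pincherle_derivative_comp_diffOp]
  exact diffOp_bijective (by rwa [constantCoeff_derivative_X_mul])

end Literature.Algebra.Polynomial
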